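import Mathlib
import HarnessLib
import Literature.MathematicalPhysics.QuantumLattice.KohnLuttinger
import Literature.MathematicalPhysics.QuantumLattice.KohnLuttingerChannelStates
import Literature.MathematicalPhysics.QuantumLattice.KohnLuttingerLindhardMeasurable
import Summits.HubbardSuperconductivity.HubbardSuperconductivity.Theorems.WeakCouplingBCSWcbcsKohnLuttingerB1gReduction
import Summits.HubbardSuperconductivity.HubbardSuperconductivity.Theorems.WeakCouplingBCSWcbcsKohnLuttingerB1gKlCertForm
import Summits.HubbardSuperconductivity.HubbardSuperconductivity.Theorems.WeakCouplingBCSKlCertTPrimePHReflection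
import Summits.HubbardSuperconductivity.HubbardSuperconductivity.Theorems.ChiralWindowCwChannelInfContinuousL2
import Summits.HubbardSuperconductivity.HubbardSuperconductivity.Theorems.ChiralWindowCwKLChiralWindowD4Invariant
import Summits.HubbardSuperconductivity.HubbardSuperconductivity.Theorems.WeakCouplingBCSKlSublatticeChannelLe
import Summits.HubbardSuperconductivity.HubbardSuperconductivity.Theorems.ChiralWindowCwThesisChannelInfNonpos
import Summits.HubbardSuperconductivity.HubbardSuperconductivity.Theorems.WeakCouplingBCSKlSublatticeDeckShift

/-!
# Sublattice duality, deck-even half: K2 of «sublattice-duality», and the duality as an EQUALITY of channel bottoms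
# («(KLSCAN)-SUBLATTICE-DUALITY-DISCHARGE» part 8; cell gate-hubbard-kl, seat p4 g20)

For `ε' = squareDispersion 0 1`, `ε = squareDispersion 1 0`, the cover `Φ = fold ∘ A`, its section `A/2` and the twist `τ`:

* §16 `klsl_half_klslA_cover`: `(A/2)(Φ k) ∈ {k, D k}` on the zone (exactly, piece by piece); `klsl_d4Project_halfA` /
  `klsl_inChannel_halfA`: `g ∈ τχ ⇒ g ∘ (A/2) ∈ χ`; `klsl_ae_eq_comp_halfA`: a `σ'`-a.e. class descends along `A/2` to a
  `σ`-a.e. class (`σ = Φ_* σ'`, `D_* σ' = σ'`);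
* **crux K2 `klsl_channelInf_sublattice_ge` / `klsl_channelInfSublatticeGe`**:
  `min (channelInf ε μ U χ) 0 ≤ channelInf ε' μ U (τχ)` for `μ ∈ (-4, 0)`, all `U`, all `χ` — a `τχ`-state of `ε'` splits into
  deck-even/odd parts, the form sees only the even part (part 7), which descends along `A/2` to a `χ`-function of `ε` with the
  same form and norm `Nₑ ≤ 1`;
* **`klsl_channelInf_sublattice_eq`**: `channelInf ε' μ U (τχ) = channelInf ε μ U χ` on `(-4, 0)` (K1 of part 6, K2, and the
  landed non-positivity `CwThesis.stub_channelInfNonpos`) — hubbard-klscan-idea-3's `channelInf_sublattice_eq` unconditionally,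
  so its `dualWindowB2g_d005_d035` / `ratioAxisBracket_d0125_of_records` hold modulo ONLY the twelve enclosure hypotheses
  of the landed window (their K1, K2, S2 arguments are `klsl_channelInfSublatticeLe`, `klsl_channelInfSublatticeGe`,
  `klsl_filling_sublattice` after `tauIrrep = klslTau`, `sublatticeMap = klslA`).

Honest framing: exact identities between two free-band channel problems; the `t = 0` cell is a relabelling of the landed `t' = 0`
theorem, far outside `t'/t ∈ [-0.3, 0]`; nothing asserts a margin at `t'/t ∈ [-0.3, 0)`, the window, `K₃` or superconductivity;
a Kohn–Luttinger `O(U²)` channel statement is not ODLRO.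
-/

noncomputable section

set_option linter.dupNamespace false

namespace Summit.HubbardSuperconductivity.HubbardSuperconductivity.Theorems

open MeasureTheory Real Set Literature.MathematicalPhysics.QuantumLattice
open scoped ENNReal Pointwise

/-! ### §16 Descent of the deck-even part along `A / 2` and crux K2 -/

/-- Every point of the zone lies in one of the five pieces. [folklore] -/
theorem klsl_mem_pieces {k : Momentum} (hk : k ∈ brillouinZone) :
    k ∈ klslP1 ∨ k ∈ klslP2 ∨ k ∈ klslP3 ∨ k ∈ klslP4 ∨ k ∈ klslP0 := by
  by_cases h1 : k ∈ {k : Momentum | π ≤ k 0 + k 1}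
  · exact Or.inl ⟨hk, h1⟩
  by_cases h2 : k ∈ {k : Momentum | k 0 + k 1 < -π}
  · exact Or.inr (Or.inl ⟨⟨hk, h1⟩, h2⟩)
  by_cases h3 : k ∈ {k : Momentum | π ≤ k 0 - k 1}
  · exact Or.inr (Or.inr (Or.inl ⟨⟨⟨hk, h1⟩, h2⟩, h3⟩))
  by_cases h4 : k ∈ {k : Momentum | k 0 - k 1 < -π}
  · exact Or.inr (Or.inr (Or.inr (Or.inl ⟨⟨⟨⟨hk, h1⟩, h2⟩, h3⟩, h4⟩)))
  · exact Or.inr (Or.inr (Or.inr (Or.inr ⟨⟨⟨⟨hk, h1⟩, h2⟩, h3⟩, h4⟩)))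

/-- **The section `A/2` of the cover**: for `k ∈ BZ`, `(A/2)(Φ k)` is `k` (central piece) or the deck partner `D k`
(corner pieces). [folklore] -/
theorem klsl_half_klslA_cover {k : Momentum} (hk : k ∈ brillouinZone) :
    (2 : ℝ)⁻¹ • klslA (klslCover k) = k ∨ (2 : ℝ)⁻¹ • klslA (klslCover k) = klphShift k := by
  rcases klsl_mem_pieces hk with h | h | h | h | h
  · right
    rw [klslCover_of_mem_P1 h]
    simp only [klslP1, mem_inter_iff, klsl_mem_brillouinZone, mem_setOf_eq] at h
    obtain ⟨⟨⟨a, b⟩, c, d⟩, e⟩ := h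
    have h0 : klphTau (k 0) = k 0 - π := klphTau_of_mem_right ⟨by linarith, b⟩
    have h1 : klphTau (k 1) = k 1 - π := klphTau_of_mem_right ⟨by linarith, d⟩
    ext i; fin_cases i
    · simp [klslA_add, h0]; ring
    · simp [klslA_add, h1]; ring
  · right
    rw [klslCover_of_mem_P2 h]
    simp only [klslP2, mem_inter_iff, mem_sdiff, klsl_mem_brillouinZone, mem_setOf_eq] at h
    obtain ⟨⟨⟨⟨a, b⟩, c, d⟩, -⟩, e⟩ := h
    have h0 : klphTau (k 0) = k 0 + π := klphTau_of_mem_left ⟨a, by linarith⟩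
    have h1 : klphTau (k 1) = k 1 + π := klphTau_of_mem_left ⟨c, by linarith⟩
    ext i; fin_cases i
    · simp [klslA_add, h0]; ring
    · simp [klslA_add, h1]; ring
  · right
    rw [klslCover_of_mem_P3 h]
    simp only [klslP3, mem_inter_iff, mem_sdiff, klsl_mem_brillouinZone, mem_setOf_eq, not_le, not_lt] at h
    obtain ⟨⟨⟨⟨⟨a, b⟩, c, d⟩, f⟩, g⟩, e⟩ := h
    have h0 : klphTau (k 0) = k 0 - π := klphTau_of_mem_right ⟨by linarith, b⟩
    have h1 : klphTau (k 1) = k 1 + π := klphTau_of_mem_left ⟨c, by linarith⟩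
    ext i; fin_cases i
    · simp [klslA_add, h0]; ring
    · simp [klslA_add, h1]; ring
  · right
    rw [klslCover_of_mem_P4 h]
    simp only [klslP4, mem_inter_iff, mem_sdiff, klsl_mem_brillouinZone, mem_setOf_eq, not_le, not_lt] at h
    obtain ⟨⟨⟨⟨⟨⟨a, b⟩, c, d⟩, f⟩, g⟩, -⟩, e⟩ := h
    have h0 : klphTau (k 0) = k 0 + π := klphTau_of_mem_left ⟨a, by linarith⟩
    have h1 : klphTau (k 1) = k 1 - π := klphTau_of_mem_right ⟨by linarith, d⟩
    ext i; fin_cases i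
    · simp [klslA_add, h0]; ring
    · simp [klslA_add, h1]; ring
  · left
    rw [klslCover_of_mem_P0 h]
    ext i; fin_cases i <;> simp [klslA_add, klslA_klslA]

/-- `A/2` intertwines the quarter turn with its inverse: `(A/2)(r u) = r³ ((A/2) u)`. [folklore] -/
theorem klsl_halfA_rotMomentum (u : Momentum) :
    (2 : ℝ)⁻¹ • klslA (rotMomentum u) = rotMomentum (rotMomentum (rotMomentum ((2 : ℝ)⁻¹ • klslA u))) := by
  ext i; fin_cases i <;> simp <;> ring

/-- `A/2` intertwines the reflection with the diagonal reflection: `(A/2)(s u) = s r³ ((A/2) u)`. [folklore] -/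
theorem klsl_halfA_reflMomentum (u : Momentum) :
    (2 : ℝ)⁻¹ • klslA (reflMomentum u) = reflMomentum (rotMomentum (rotMomentum (rotMomentum ((2 : ℝ)⁻¹ • klslA u)))) := by
  ext i; fin_cases i
  · simp; ring
  · simp

/-- **Intertwining of the isotypic projections along `A/2`**: `P_χ (g ∘ A/2)(u) = (P_{τχ} g)((A/2) u)`. [folklore] -/
theorem klsl_d4Project_halfA (χ : D4Irrep) (g : Momentum → ℝ) (u : Momentum) :
    d4Project χ (g ∘ fun v => (2 : ℝ)⁻¹ • klslA v) u = d4Project (klslTau χ) g ((2 : ℝ)⁻¹ • klslA u) := by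
  set w := (2 : ℝ)⁻¹ • klslA u with hw
  have e1 : (2 : ℝ)⁻¹ • klslA (rotMomentum u) = rotMomentum (rotMomentum (rotMomentum w)) := klsl_halfA_rotMomentum u
  have e2 : (2 : ℝ)⁻¹ • klslA (rotMomentum (rotMomentum u)) = rotMomentum (rotMomentum w) := by
    rw [klsl_halfA_rotMomentum, e1, kl_d4_rot_rot_rot_rot]
  have e3 : (2 : ℝ)⁻¹ • klslA (rotMomentum (rotMomentum (rotMomentum u))) = rotMomentum w := by
    rw [klsl_halfA_rotMomentum, e2, kl_d4_rot_rot_rot_rot]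
  have f0 : (2 : ℝ)⁻¹ • klslA (reflMomentum u) = reflMomentum (rotMomentum (rotMomentum (rotMomentum w))) :=
    klsl_halfA_reflMomentum u
  have f1 : (2 : ℝ)⁻¹ • klslA (reflMomentum (rotMomentum u)) = reflMomentum (rotMomentum (rotMomentum w)) := by
    rw [klsl_halfA_reflMomentum, e1, kl_d4_rot_rot_rot_rot]
  have f2 : (2 : ℝ)⁻¹ • klslA (reflMomentum (rotMomentum (rotMomentum u))) = reflMomentum (rotMomentum w) := by
    rw [klsl_halfA_reflMomentum, e2, kl_d4_rot_rot_rot_rot]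
  have f3 : (2 : ℝ)⁻¹ • klslA (reflMomentum (rotMomentum (rotMomentum (rotMomentum u)))) = reflMomentum w := by
    rw [klsl_halfA_reflMomentum, e3, kl_d4_rot_rot_rot_rot]
  have ne10 : (1 : ZMod 4) ≠ 0 := by decide
  have ne12 : (1 : ZMod 4) ≠ 2 := by decide
  have ne20 : (2 : ZMod 4) ≠ 0 := by decide
  have ne30 : (3 : ZMod 4) ≠ 0 := by decide
  have ne32 : (3 : ZMod 4) ≠ 2 := by decide
  simp only [d4Project, sum_dihedralGroup_four, d4Momentum_r_zero, d4Momentum_r_one, d4Momentum_r_two,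
    d4Momentum_r_three, d4Momentum_sr_zero, d4Momentum_sr_one, d4Momentum_sr_two, d4Momentum_sr_three,
    Function.comp_apply, ← hw, e1, e2, e3, f0, f1, f2, f3]
  cases χ <;>
  · simp only [klslTau, D4Irrep.char, D4Irrep.dim, zmod_four_val.1, zmod_four_val.2.1, zmod_four_val.2.2.1,
      zmod_four_val.2.2.2, ne10, ne12, ne20, ne30, ne32, if_true, if_false]
    norm_num
    try ring

/-- `g ∈ τχ ⇒ g ∘ (A/2) ∈ χ`. [folklore] -/
theorem klsl_inChannel_halfA {χ : D4Irrep} {g : Momentum → ℝ} (h : InChannel (klslTau χ) g) :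
    InChannel χ (g ∘ fun v => (2 : ℝ)⁻¹ • klslA v) := by
  funext u
  rw [klsl_d4Project_halfA, Function.comp_apply]
  exact congrFun h _

/-- **A deck-even a.e. class descends measurably**: if `e =ᵐ[σ'] g` with `g` strongly measurable, then
`e ∘ (A/2) =ᵐ[σ] g ∘ (A/2)` — because `σ = Φ_* σ'` and `(A/2)(Φ k) ∈ {k, D k}` with `D_* σ' = σ'`. [folklore] -/
theorem klsl_ae_eq_comp_halfA (μ : ℝ) {e g : Momentum → ℝ}
    (h : e =ᵐ[fermiCurveMeasure (squareDispersion 0 1) μ] g) :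
    (e ∘ fun v => (2 : ℝ)⁻¹ • klslA v) =ᵐ[fermiCurveMeasure (squareDispersion 1 0) μ] (g ∘ fun v => (2 : ℝ)⁻¹ • klslA v) := by
  -- a measurable, D-symmetric null set containing `{e ≠ g}`
  set N := toMeasurable (fermiCurveMeasure (squareDispersion 0 1) μ) {k | e k ≠ g k} with hN
  have hN0 : fermiCurveMeasure (squareDispersion 0 1) μ N = 0 := by rw [hN, measure_toMeasurable]; exact ae_iff.1 h
  have hNm : MeasurableSet N := measurableSet_toMeasurable _ _
  have hDN0 : fermiCurveMeasure (squareDispersion 0 1) μ (klphShift ⁻¹' N) = 0 := by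
    rw [(klsl_measurePreserving_shift_nnn μ).measure_preimage hNm.nullMeasurableSet]; exact hN0
  have hAm : Measurable fun v : Momentum => (2 : ℝ)⁻¹ • klslA v := (measurable_const_smul _).comp measurable_klslA
  have hT : MeasurableSet ((fun v : Momentum => (2 : ℝ)⁻¹ • klslA v) ⁻¹' (N ∪ klphShift ⁻¹' N)) :=
    hAm (hNm.union (klph_measurable_shift hNm))
  have hBZ0 : fermiCurveMeasure (squareDispersion 0 1) μ brillouinZoneᶜ = 0 :=
    measure_eq_zero_iff_ae_notMem.2 ((ae_mem_fermiCurve (measurable_squareDispersion 0 1) μ).mono fun k hk h => h hk.1)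
  -- its `A/2`-preimage is `σ`-null
  have hσT : fermiCurveMeasure (squareDispersion 1 0) μ ((fun v : Momentum => (2 : ℝ)⁻¹ • klslA v) ⁻¹' (N ∪ klphShift ⁻¹' N)) = 0 := by
    rw [← klsl_map_cover_fermiCurveMeasure μ, Measure.map_apply measurable_klslCover hT]
    refine measure_mono_null (fun k hk => ?_) (measure_union_null (measure_union_null hN0 hDN0) hBZ0)
    by_cases hkB : k ∈ brillouinZone
    · left
      have hk' : (2 : ℝ)⁻¹ • klslA (klslCover k) ∈ N ∪ klphShift ⁻¹' N := hk
      rcases klsl_half_klslA_cover hkB with h1 | h1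
      · rw [h1] at hk'; exact hk'
      · rw [h1] at hk'
        rcases hk' with h2 | h2
        · exact Or.inr h2
        · left
          have : klphShift (klphShift k) ∈ N := h2
          rwa [klphShift_klphShift] at this
    · exact Or.inr hkB
  rw [Filter.EventuallyEq, ae_iff]
  refine measure_mono_null (fun u hu => ?_) hσT
  have hu' : e ((2 : ℝ)⁻¹ • klslA u) ≠ g ((2 : ℝ)⁻¹ • klslA u) := hu
  exact Or.inl (subset_toMeasurable _ _ hu')

/-- **Crux K2 `ChannelInfSublatticeGe` — the deck-even half of the sublattice duality**: for `μ ∈ (-4, 0)`, every `U` and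
every channel `χ`, `min (channelInf (squareDispersion 1 0) μ U χ) 0 ≤ channelInf (squareDispersion 0 1) μ U (τχ)`.
Every `τχ`-state `ψ'` of `ε'` splits as `ψ' = ψₑ + ψₒ` into its deck-even/odd parts (`ψₒ ∘ D = -ψₒ` a.e.); the pairing form only
sees `ψₑ` (`klsl_pairingForm_even_odd`); `ψₑ` descends along the section `A/2` to `φ₀ = ψₑ ∘ (A/2)`, a `χ`-function of `ε`
with `φ₀ ∘ Φ = ψₑ` a.e., the same norm `Nₑ ≤ 1` and the same form; normalising, `⟨ψ', Γ'ψ'⟩ = Nₑ ⟨φ, Γφ⟩ ≥ Nₑ · channelInf ε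
≥ min (channelInf ε, 0)`. [cite: RaghuKivelsonScalapino2010, §II (7) and (13)] -/
theorem klsl_channelInf_sublattice_ge {μ : ℝ} (hμ : μ ∈ Ioo (-4 : ℝ) 0) (U : ℝ) (χ : D4Irrep) :
    min (channelInf (squareDispersion 1 0) μ U χ) 0 ≤ channelInf (squareDispersion 0 1) μ U (klslTau χ) := by
  haveI := klsl_isFiniteMeasure_nnn hμ
  haveI := stub_klFiniteMeasure stub_klGradient stub_klHausdorffFinite μ hμ
  set c := channelInf (squareDispersion 1 0) μ U χ with hc
  unfold channelInf
  by_cases hne : ((pairingForm (squareDispersion 0 1) μ U) ''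
      {ψ | IsChannelState (squareDispersion 0 1) μ (klslTau χ) ψ}).Nonempty
  swap
  · rw [Set.not_nonempty_iff_eq_empty.1 hne, Real.sInf_empty]; exact min_le_right _ _
  refine le_csInf hne ?_
  rintro x ⟨ψ', ⟨hmem, hnorm, hch⟩, rfl⟩
  -- the deck partner and the even / odd parts
  have hmp := klsl_measurePreserving_shift_nnn μ
  have hG := klsl_ae_mem_klphGood_nnn μ
  have haeD : klphGood.indicator (ψ' ∘ klphShift) =ᵐ[fermiCurveMeasure (squareDispersion 0 1) μ] (ψ' ∘ klphShift) := by
    filter_upwards [hG] with k hk; simp only [Set.indicator_of_mem hk]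
  have hmemD : MemLp (klphGood.indicator (ψ' ∘ klphShift)) 2 (fermiCurveMeasure (squareDispersion 0 1) μ) :=
    (hmem.comp_measurePreserving hmp).ae_eq haeD.symm
  have hchD : InChannel (klslTau χ) (klphGood.indicator (ψ' ∘ klphShift)) := klsl_inChannel_shift hch
  set e : Momentum → ℝ := fun k => 2⁻¹ * ψ' k + 2⁻¹ * klphGood.indicator (ψ' ∘ klphShift) k with hedef
  set o : Momentum → ℝ := fun k => 2⁻¹ * ψ' k + (-2⁻¹) * klphGood.indicator (ψ' ∘ klphShift) k with hodef
  have he : MemLp e 2 (fermiCurveMeasure (squareDispersion 0 1) μ) := (hmem.const_mul _).add (hmemD.const_mul _)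
  have ho : MemLp o 2 (fermiCurveMeasure (squareDispersion 0 1) μ) := (hmem.const_mul _).add (hmemD.const_mul _)
  have hche : InChannel (klslTau χ) e := kl_hc_inChannel_linear _ _ _ _ _ hch hchD
  have hfe : ∀ k, ψ' k = e k + o k := fun k => by simp only [hedef, hodef]; ring
  have hodd : ∀ᵐ k ∂fermiCurveMeasure (squareDispersion 0 1) μ, o (klphShift k) = -o k := by
    filter_upwards [hG] with k hk
    have hk' := klsl_klphShift_mem_klphGood hk
    simp only [hodef, Set.indicator_of_mem hk, Set.indicator_of_mem hk', Function.comp_apply, klphShift_klphShift]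
    ring
  have heven : ∀ᵐ k ∂fermiCurveMeasure (squareDispersion 0 1) μ, e (klphShift k) = e k := by
    filter_upwards [hG] with k hk
    have hk' := klsl_klphShift_mem_klphGood hk
    simp only [hedef, Set.indicator_of_mem hk, Set.indicator_of_mem hk', Function.comp_apply, klphShift_klphShift]
    ring
  have hform : pairingForm (squareDispersion 0 1) μ U ψ' = pairingForm (squareDispersion 0 1) μ U e :=
    klsl_pairingForm_even_odd hμ U he ho hfe hodd
  -- the descended function
  set φ₀ : Momentum → ℝ := e ∘ fun v => (2 : ℝ)⁻¹ • klslA v with hφ₀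
  have hchφ₀ : InChannel χ φ₀ := klsl_inChannel_halfA hche
  have hback : φ₀ ∘ klslCover =ᵐ[fermiCurveMeasure (squareDispersion 0 1) μ] e := by
    filter_upwards [heven, ae_mem_fermiCurve (measurable_squareDispersion 0 1) μ] with k hk hF
    simp only [hφ₀, Function.comp_apply]
    rcases klsl_half_klslA_cover hF.1 with h1 | h1
    · rw [h1]
    · rw [h1, hk]
  have hφ₀m : AEStronglyMeasurable φ₀ (fermiCurveMeasure (squareDispersion 1 0) μ) := by
    refine ⟨he.1.mk e ∘ fun v => (2 : ℝ)⁻¹ • klslA v,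
      he.1.stronglyMeasurable_mk.comp_measurable ((measurable_const_smul _).comp measurable_klslA), ?_⟩
    exact klsl_ae_eq_comp_halfA μ he.1.ae_eq_mk
  have hφ₀sq : AEStronglyMeasurable (fun u => φ₀ u ^ 2) (fermiCurveMeasure (squareDispersion 1 0) μ) := hφ₀m.pow 2
  have hmemφ₀ : MemLp φ₀ 2 (fermiCurveMeasure (squareDispersion 1 0) μ) := by
    rw [← klsl_map_cover_fermiCurveMeasure μ] at hφ₀m ⊢
    exact (memLp_map_measure_iff hφ₀m measurable_klslCover.aemeasurable).2 (he.ae_eq hback.symm)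
  -- norms and forms agree
  obtain ⟨N, hN⟩ : ∃ N : ℝ, ∫ k, e k ^ 2 ∂fermiCurveMeasure (squareDispersion 0 1) μ = N := ⟨_, rfl⟩
  have hNφ : ∫ u, φ₀ u ^ 2 ∂fermiCurveMeasure (squareDispersion 1 0) μ = N := by
    rw [← hN, ← klsl_integral_comp_cover μ hφ₀sq]
    exact integral_congr_ae (hback.mono fun k hk => by simp only [← hk, Function.comp_apply])
  have hPφ : pairingForm (squareDispersion 1 0) μ U φ₀ = pairingForm (squareDispersion 0 1) μ U e := by
    rw [← klsl_pairingForm_comp_cover hμ hmemφ₀ U]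
    exact klsl_pairingForm_congr_ae U hback
  -- `0 ≤ N ≤ 1`
  have hN0 : 0 ≤ N := hN ▸ integral_nonneg fun k => sq_nonneg _
  have hnormD : ∫ k, klphGood.indicator (ψ' ∘ klphShift) k ^ 2 ∂fermiCurveMeasure (squareDispersion 0 1) μ = 1 := by
    have h1 : ∫ k, klphGood.indicator (ψ' ∘ klphShift) k ^ 2 ∂fermiCurveMeasure (squareDispersion 0 1) μ =
        ∫ k, (fun u => ψ' u ^ 2) (klphShift k) ∂fermiCurveMeasure (squareDispersion 0 1) μ :=
      integral_congr_ae (haeD.mono fun k hk => by simp only [hk, Function.comp_apply])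
    rw [h1, hmp.integral_comp klph_measurableEmbedding_shift (fun u => ψ' u ^ 2)]
    exact hnorm
  have hsq1 : Integrable (fun k => ψ' k ^ 2) (fermiCurveMeasure (squareDispersion 0 1) μ) :=
    (memLp_two_iff_integrable_sq hmem.1).1 hmem
  have hsq2 : Integrable (fun k => klphGood.indicator (ψ' ∘ klphShift) k ^ 2) (fermiCurveMeasure (squareDispersion 0 1) μ) :=
    (memLp_two_iff_integrable_sq hmemD.1).1 hmemD
  have hN1 : N ≤ 1 := by
    have hle : ∀ k, e k ^ 2 ≤ 2⁻¹ * ψ' k ^ 2 + 2⁻¹ * klphGood.indicator (ψ' ∘ klphShift) k ^ 2 := by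
      intro k
      simp only [hedef]
      nlinarith [sq_nonneg (ψ' k - klphGood.indicator (ψ' ∘ klphShift) k)]
    have hi1 : Integrable (fun k => 2⁻¹ * ψ' k ^ 2) (fermiCurveMeasure (squareDispersion 0 1) μ) := hsq1.const_mul 2⁻¹
    have hi2 : Integrable (fun k => 2⁻¹ * klphGood.indicator (ψ' ∘ klphShift) k ^ 2)
        (fermiCurveMeasure (squareDispersion 0 1) μ) := hsq2.const_mul 2⁻¹
    have hi12 : Integrable (fun k => 2⁻¹ * ψ' k ^ 2 + 2⁻¹ * klphGood.indicator (ψ' ∘ klphShift) k ^ 2)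
        (fermiCurveMeasure (squareDispersion 0 1) μ) := hi1.add hi2
    have hnn : (0 : Momentum → ℝ) ≤ᵐ[fermiCurveMeasure (squareDispersion 0 1) μ] fun k => e k ^ 2 :=
      Filter.Eventually.of_forall fun k => sq_nonneg (e k)
    have hmono := integral_mono_of_nonneg hnn hi12 (Filter.Eventually.of_forall hle)
    rw [hN, integral_add hi1 hi2, integral_const_mul, integral_const_mul, hnorm, hnormD] at hmono
    linarith
  -- conclusion
  rw [hform]
  rcases hN0.eq_or_lt with hNz | hNpos
  · -- `e = 0` a.e.: the form vanishes
    have he0 : e =ᵐ[fermiCurveMeasure (squareDispersion 0 1) μ] 0 := by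
      have hint0 : ∫ k, e k ^ 2 ∂fermiCurveMeasure (squareDispersion 0 1) μ = 0 := by rw [hN, ← hNz]
      have h0 := (integral_eq_zero_iff_of_nonneg (fun k => sq_nonneg (e k)) ((memLp_two_iff_integrable_sq he.1).1 he)).1 hint0
      filter_upwards [h0] with k hk
      simpa using hk
    rw [klsl_pairingForm_congr_ae U he0]
    simp only [pairingForm, Pi.zero_apply, mul_zero, integral_zero]
    exact min_le_right _ _
  · -- normalise `φ₀`
    set φ : Momentum → ℝ := fun u => (Real.sqrt N)⁻¹ * φ₀ u with hφ
    have hsN : 0 < Real.sqrt N := Real.sqrt_pos.2 hNpos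
    have hc2 : (Real.sqrt N)⁻¹ ^ 2 * N = 1 := by
      rw [inv_pow, Real.sq_sqrt hNpos.le, inv_mul_cancel₀ hNpos.ne']
    have hstate : IsChannelState (squareDispersion 1 0) μ χ φ := by
      refine ⟨hmemφ₀.const_mul _, ?_, ?_⟩
      · simp only [hφ, mul_pow]
        rw [integral_const_mul, hNφ, hc2]
      · have h := kl_hc_inChannel_linear χ φ₀ φ₀ (Real.sqrt N)⁻¹ 0 hchφ₀ hchφ₀
        simpa [hφ] using h
    have hval : pairingForm (squareDispersion 1 0) μ U φ = (Real.sqrt N)⁻¹ ^ 2 * pairingForm (squareDispersion 0 1) μ U e := by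
      rw [← hPφ]
      simp only [pairingForm, hφ]
      exact klb1g_form_smul _ _ _ _
    have hcle : c ≤ pairingForm (squareDispersion 1 0) μ U φ := by
      rw [hc]
      exact csInf_le ((klsl_bddBelow_nnn hμ U (klslTau χ)).mono (klsl_pairingForm_image_subset hμ U χ)) ⟨φ, hstate, rfl⟩
    rw [hval, inv_pow, Real.sq_sqrt hNpos.le] at hcle
    -- `c ≤ P/N`, `0 < N ≤ 1` ⇒ `min c 0 ≤ P`
    have hP : N * c ≤ pairingForm (squareDispersion 0 1) μ U e := by
      have := mul_le_mul_of_nonneg_left hcle hNpos.le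
      rwa [mul_inv_cancel_left₀ hNpos.ne'] at this
    rcases le_or_gt c 0 with hc0 | hc0
    · rw [min_eq_left hc0]; nlinarith
    · rw [min_eq_right hc0.le]; nlinarith

/-- K2 in the shape of hubbard-klscan-idea-3's `KlSublattice.ChannelInfSublatticeGe` (with `klslTau` for its `tauIrrep`). [folklore] -/
theorem klsl_channelInfSublatticeGe :
    ∀ μ ∈ Set.Ioo (-4 : ℝ) 0, ∀ U : ℝ, ∀ χ : D4Irrep,
      min (channelInf (squareDispersion 1 0) μ U χ) 0 ≤ channelInf (squareDispersion 0 1) μ U (klslTau χ) :=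
  fun _ hμ U χ => klsl_channelInf_sublattice_ge hμ U χ

/-- **The sublattice duality is an equality of channel bottoms** on `μ ∈ (-4, 0)`:
`channelInf (squareDispersion 0 1) μ U (τχ) = channelInf (squareDispersion 1 0) μ U χ` (K1, K2 and the landed
non-positivity `CwThesis.stub_channelInfNonpos` of the `t`-band bottoms). [cite: RaghuKivelsonScalapino2010, §II (13)] -/
theorem klsl_channelInf_sublattice_eq {μ : ℝ} (hμ : μ ∈ Ioo (-4 : ℝ) 0) (U : ℝ) (χ : D4Irrep) :
    channelInf (squareDispersion 0 1) μ U (klslTau χ) = channelInf (squareDispersion 1 0) μ U χ := by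
  refine le_antisymm (klsl_channelInf_sublattice_le hμ U χ) ?_
  have h := klsl_channelInf_sublattice_ge hμ U χ
  rwa [min_eq_left (CwThesis.stub_channelInfNonpos U χ hμ)] at h

end Summit.HubbardSuperconductivity.HubbardSuperconductivity.Theorems

end
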